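import Summits.Ventures.YMGap.Thresholds.OneLinkCubicWords
import Summits.Ventures.YMGap.Thresholds.OneLinkCasimirTwo
import HarnessLib

/-!
# Venture YMGap — the one-link modulus beyond first order, part 41: the DEGREE-THREE CASIMIR CALCULUS — Laplacian of the cubic
# word `Re tr(QM₁QM₂QM₃)` and its carré du champ against the potential (first foundation file of level three)

HONEST FRAMING: venture file of the cell `pub-ymgap` (QuantumFields programme), strong-coupling LATTICE bookkeeping for `SU(N)`
lattice Yang–Mills; nothing about the continuum or the mass gap in the Clay sense.  Pure matrix calculus, no measure, no number of
record: the degree-three analogue of `OneLinkCasimirTwo` / `OneLinkFeedback`, i.e. the algebra that a third-order Poisson solution of the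
linear statistic needs (cell note `HOME/p2/ONE-LINK-HIERARCHY.md` §15 (3)(a)–(b)).

WHAT.  `D_Y F(Q) = dF(Q)[QY]`, `(Y_α)` the Parseval frame of `𝔰𝔲(N)`, `Δ = Σ_α D_α²`, `Γ(F,G) = Σ_α D_αF·D_αG` (tree conventions).
* `matD_matD_reTrCubic`: the second derivative of `Re tr(QM₁QM₂QM₃)` along `Y` (three `Y²`-insertions, three sandwiches, in the
  `P·(Y X Y)·R` format of the frame identities);
* `Lap_reTrCubic` (THE CASIMIR ACTION):
  `Δ Re tr(QM₁QM₂QM₃) = −(3N − 9/N)·Re tr(QM₁QM₂QM₃) − 2Re[tr(QM₁)tr(QM₂QM₃) + tr(QM₃)tr(QM₁QM₂) + tr(QM₂)tr(QM₁QM₃)]`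
  (single-trace cubic words map to themselves plus one-trace-split products: the `Sym³ / (2,1) / Λ³` Casimirs `3N − 9/N + {6, 0, −6}`
  appear after symmetrisation; valid ambiently on `M_N(ℂ)`);
* `Gam_potB_reTrCubic` (THE FEEDBACK RULE at degree three, on `SU(N)`):
  `Γ(Re tr(·B), Re tr(·M₁·M₂·M₃))(g) = −½Σ_{cyc} Re tr(BgM_igM_jgM_kg) + ½Σ_{cyc} Re tr(gM_jgM_k·BᴴM_i·) − (3/N)·Im tr(Bg)·Im tr(gM₁gM₂gM₃)`
  — degree `3 ↦ {4, 2}` plus the `1/N` trace term, exactly as the degree-two rule `OneLinkFeedback.Gam_potB_reTrQuad`.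

References: cell note `HOME/p2/ONE-LINK-HIERARCHY.md` §2, §15 (3).
-/

noncomputable section

open scoped Matrix ComplexConjugate BigOperators
open Matrix Complex Finset
open Literature.MathematicalPhysics.QuantumFieldTheory
open Literature.MathematicalPhysics.QuantumFieldTheory.SUNBakryEmery

namespace Summit.Ventures.YMGap.OneLinkEigen

variable {N : ℕ}

section Calc

open scoped Matrix.Norms.Frobenius ContDiff Topology

/-! ### The second derivative and the Laplacian of the cubic word -/

/-- **Second derivative of `Re tr(QM₁QM₂QM₃)` along `Y`**: three `Y²`-insertions and three sandwiches (each twice). [folklore] -/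
theorem matD_matD_reTrCubic (Y M₁ M₂ M₃ : Matrix (Fin N) (Fin N) ℂ) (Q : Matrix (Fin N) (Fin N) ℂ) :
    matD Y (matD Y (fun Q : Matrix (Fin N) (Fin N) ℂ => (Q * M₁ * Q * M₂ * Q * M₃).trace.re)) Q =
      (Q * (Y * Y) * (M₁ * Q * M₂ * Q * M₃)).trace.re
        + (Q * M₁ * Q * (Y * Y) * (M₂ * Q * M₃)).trace.re
        + (Q * M₁ * Q * M₂ * Q * (Y * Y) * M₃).trace.re
        + 2 * (Q * (Y * (M₁ * Q) * Y) * (M₂ * Q * M₃)).trace.re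
        + 2 * (Q * (Y * (M₁ * Q * M₂ * Q) * Y) * M₃).trace.re
        + 2 * (Q * M₁ * Q * (Y * (M₂ * Q) * Y) * M₃).trace.re := by
  rw [matD_reTrCubic]
  have e1 : (fun Q : Matrix (Fin N) (Fin N) ℂ => (Q * Y * M₁ * Q * M₂ * Q * M₃).trace.re
        + (Q * M₁ * Q * Y * M₂ * Q * M₃).trace.re + (Q * M₁ * Q * M₂ * Q * Y * M₃).trace.re)
      = ((fun Q : Matrix (Fin N) (Fin N) ℂ => (Q * (Y * M₁) * Q * M₂ * Q * M₃).trace.re)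
          + fun Q : Matrix (Fin N) (Fin N) ℂ => (Q * M₁ * Q * (Y * M₂) * Q * M₃).trace.re)
        + fun Q : Matrix (Fin N) (Fin N) ℂ => (Q * M₁ * Q * M₂ * Q * (Y * M₃)).trace.re := by
    funext Q; simp only [Pi.add_apply, Matrix.mul_assoc]
  have c1 : ContDiff ℝ ∞ (fun Q : Matrix (Fin N) (Fin N) ℂ => (Q * (Y * M₁) * Q * M₂ * Q * M₃).trace.re) :=
    contDiff_reTrCubic _ _ _
  have c2 : ContDiff ℝ ∞ (fun Q : Matrix (Fin N) (Fin N) ℂ => (Q * M₁ * Q * (Y * M₂) * Q * M₃).trace.re) :=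
    contDiff_reTrCubic _ _ _
  have c3 : ContDiff ℝ ∞ (fun Q : Matrix (Fin N) (Fin N) ℂ => (Q * M₁ * Q * M₂ * Q * (Y * M₃)).trace.re) :=
    contDiff_reTrCubic _ _ _
  have c12 : ContDiff ℝ ∞ ((fun Q : Matrix (Fin N) (Fin N) ℂ => (Q * (Y * M₁) * Q * M₂ * Q * M₃).trace.re)
      + fun Q : Matrix (Fin N) (Fin N) ℂ => (Q * M₁ * Q * (Y * M₂) * Q * M₃).trace.re) := c1.add c2
  rw [e1, matD_add c12 c3, matD_add c1 c2]
  simp only [Pi.add_apply]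
  rw [matD_reTrCubic, matD_reTrCubic, matD_reTrCubic]
  simp only [Matrix.mul_assoc]
  ring

/-- **Casimir action on the cubic word**:
`Δ Re tr(QM₁QM₂QM₃) = −(3N − 9/N) Re tr(QM₁QM₂QM₃) − 2 Re[tr(QM₁)tr(QM₂QM₃) + tr(QM₃)tr(QM₁QM₂) + tr(QM₂)tr(QM₁QM₃)]`. [folklore] -/
theorem Lap_reTrCubic (hN : N ≠ 0) (M₁ M₂ M₃ : Matrix (Fin N) (Fin N) ℂ) :
    Lap (fun Q : Matrix (Fin N) (Fin N) ℂ => (Q * M₁ * Q * M₂ * Q * M₃).trace.re) = fun Q =>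
      -((3 * (N : ℝ) - 9 / N) * (Q * M₁ * Q * M₂ * Q * M₃).trace.re)
        - 2 * ((Q * M₁).trace * (Q * M₂ * Q * M₃).trace).re
        - 2 * ((Q * M₃).trace * (Q * M₁ * Q * M₂).trace).re
        - 2 * ((Q * M₂).trace * (Q * M₁ * Q * M₃).trace).re := by
  funext Q
  show ∑ α, matD (frame α) (matD (frame α) (fun Q : Matrix (Fin N) (Fin N) ℂ => (Q * M₁ * Q * M₂ * Q * M₃).trace.re)) Q = _
  simp_rw [matD_matD_reTrCubic]
  rw [sum_add_distrib, sum_add_distrib, sum_add_distrib, sum_add_distrib, sum_add_distrib, ← mul_sum, ← mul_sum, ← mul_sum,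
    sum_re_trace_frame_sq hN, sum_re_trace_frame_sq hN, sum_re_trace_frame_sq hN,
    sum_re_trace_frame_sandwich hN, sum_re_trace_frame_sandwich hN, sum_re_trace_frame_sandwich hN]
  -- normalise the trace atoms
  have e1 : (Q * (M₁ * Q * M₂ * Q * M₃)).trace.re = (Q * M₁ * Q * M₂ * Q * M₃).trace.re := by simp only [Matrix.mul_assoc]
  have e2 : (Q * M₁ * Q * (M₂ * Q * M₃)).trace.re = (Q * M₁ * Q * M₂ * Q * M₃).trace.re := by simp only [Matrix.mul_assoc]
  have e3 : (Q * (M₁ * Q) * (M₂ * Q * M₃)).trace.re = (Q * M₁ * Q * M₂ * Q * M₃).trace.re := by simp only [Matrix.mul_assoc]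
  have e4 : (Q * (M₁ * Q * M₂ * Q) * M₃).trace.re = (Q * M₁ * Q * M₂ * Q * M₃).trace.re := by simp only [Matrix.mul_assoc]
  have e5 : (Q * M₁ * Q * (M₂ * Q) * M₃).trace.re = (Q * M₁ * Q * M₂ * Q * M₃).trace.re := by simp only [Matrix.mul_assoc]
  have t1 : (M₁ * Q).trace = (Q * M₁).trace := trace_mul_comm _ _
  have t2 : (M₁ * Q * M₂ * Q).trace = (Q * M₁ * Q * M₂).trace := by
    rw [show M₁ * Q * M₂ * Q = (M₁ * Q * M₂) * Q by simp only [Matrix.mul_assoc], trace_mul_comm]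
    simp only [Matrix.mul_assoc]
  have t3 : (M₂ * Q).trace = (Q * M₂).trace := trace_mul_comm _ _
  have t4 : (Q * (M₂ * Q * M₃)).trace = (Q * M₂ * Q * M₃).trace := by simp only [Matrix.mul_assoc]
  have t5 : (Q * M₁ * Q * M₃).trace = (Q * M₁ * Q * M₃).trace := rfl
  rw [e1, e2, e3, e4, e5, t1, t2, t3, t4]
  ring

/-! ### The feedback rule at degree three -/

/-- **`Γ(Re tr(·B), Re tr(·M₁·M₂·M₃))` on `SU(N)`**: for `g ∈ SU(N)`,
`Γ = −½[Re tr(BgM₁gM₂gM₃g) + Re tr(BgM₂gM₃gM₁g) + Re tr(BgM₃gM₁gM₂g)]`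
`    + ½[Re tr(gM₂gM₃BᴴM₁) + Re tr(gM₃gM₁BᴴM₂) + Re tr(gM₁gM₂BᴴM₃)] − (3/N)·Im tr(Bg)·Im tr(gM₁gM₂gM₃)`
(bilinear Parseval `sum_re_trace_frame_mul_mul`; the three gradient words of the cubic word have the same trace). [folklore] -/
theorem Gam_potB_reTrCubic (hN : N ≠ 0) (B M₁ M₂ M₃ : Matrix (Fin N) (Fin N) ℂ) (g : SUN N) :
    Gam (pot 1 B) (fun Q : Matrix (Fin N) (Fin N) ℂ => (Q * M₁ * Q * M₂ * Q * M₃).trace.re) g =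
      -(1 / 2) * ((B * g * M₁ * g * M₂ * g * M₃ * g).trace.re + (B * g * M₂ * g * M₃ * g * M₁ * g).trace.re
          + (B * g * M₃ * g * M₁ * g * M₂ * g).trace.re)
        + (1 / 2) * (((g : Matrix (Fin N) (Fin N) ℂ) * M₂ * g * (M₃ * Bᴴ * M₁)).trace.re
          + ((g : Matrix (Fin N) (Fin N) ℂ) * M₃ * g * (M₁ * Bᴴ * M₂)).trace.re
          + ((g : Matrix (Fin N) (Fin N) ℂ) * M₁ * g * (M₂ * Bᴴ * M₃)).trace.re)
        - (3 / N) * (B * (g : Matrix (Fin N) (Fin N) ℂ)).trace.im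
          * ((g : Matrix (Fin N) (Fin N) ℂ) * M₁ * g * M₂ * g * M₃).trace.im := by
  set Q : Matrix (Fin N) (Fin N) ℂ := (g : Matrix (Fin N) (Fin N) ℂ) with hQ
  have hg := SUN.mem_unitaryGroup g
  have hQQ : Q * Qᴴ = 1 := by
    have h := Matrix.mem_unitaryGroup_iff.1 hg
    rw [Matrix.star_eq_conjTranspose] at h
    rw [hQ]; exact h
  -- the gradient word of the cubic word
  set G : Matrix (Fin N) (Fin N) ℂ := M₁ * Q * M₂ * Q * M₃ * Q + M₂ * Q * M₃ * Q * M₁ * Q + M₃ * Q * M₁ * Q * M₂ * Q with hG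
  have h1 : ∀ α : FrameIdx N, matD (frame α) (pot (N := N) 1 B) Q = (frame α * (B * Q)).trace.re := by
    intro α
    have h : matD (frame α) (pot (N := N) 1 B) Q = 1 * (Q * frame α * B).trace.re :=
      congrFun (matD_const_mul_reTrMul (N := N) 1 (frame α) B) Q
    rw [h, one_mul, show Q * frame α * B = Q * (frame α * B) by rw [Matrix.mul_assoc], trace_mul_comm, Matrix.mul_assoc]
  have h2 : ∀ α : FrameIdx N, matD (frame α) (fun Q : Matrix (Fin N) (Fin N) ℂ => (Q * M₁ * Q * M₂ * Q * M₃).trace.re) Q =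
      (frame α * G).trace.re := by
    intro α
    rw [matD_reTrCubic]
    show (Q * frame α * M₁ * Q * M₂ * Q * M₃).trace.re + (Q * M₁ * Q * frame α * M₂ * Q * M₃).trace.re
      + (Q * M₁ * Q * M₂ * Q * frame α * M₃).trace.re = _
    rw [hG, Matrix.mul_add, Matrix.mul_add, trace_add, trace_add, Complex.add_re, Complex.add_re]
    have a1 : (Q * frame α * M₁ * Q * M₂ * Q * M₃).trace = (frame α * (M₁ * Q * M₂ * Q * M₃ * Q)).trace := by
      rw [show Q * frame α * M₁ * Q * M₂ * Q * M₃ = Q * (frame α * M₁ * Q * M₂ * Q * M₃) by simp only [Matrix.mul_assoc],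
        trace_mul_comm]
      simp only [Matrix.mul_assoc]
    have a2 : (Q * M₁ * Q * frame α * M₂ * Q * M₃).trace = (frame α * (M₂ * Q * M₃ * Q * M₁ * Q)).trace := by
      rw [show Q * M₁ * Q * frame α * M₂ * Q * M₃ = (Q * M₁ * Q) * (frame α * M₂ * Q * M₃) by simp only [Matrix.mul_assoc],
        trace_mul_comm]
      simp only [Matrix.mul_assoc]
    have a3 : (Q * M₁ * Q * M₂ * Q * frame α * M₃).trace = (frame α * (M₃ * Q * M₁ * Q * M₂ * Q)).trace := by
      rw [show Q * M₁ * Q * M₂ * Q * frame α * M₃ = (Q * M₁ * Q * M₂ * Q) * (frame α * M₃) by simp only [Matrix.mul_assoc],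
        trace_mul_comm]
      simp only [Matrix.mul_assoc]
    rw [a1, a2, a3]
  simp only [Gam, h1, h2]
  rw [sum_re_trace_frame_mul_mul hN]
  -- the three atoms: `tr(BQ·G)` (quartic words), `tr(BQ·Gᴴ)` (quadratic words), `Im tr G = 3 Im tr(w₃)`
  have hBG : (B * Q * G).trace.re = (B * Q * M₁ * Q * M₂ * Q * M₃ * Q).trace.re + (B * Q * M₂ * Q * M₃ * Q * M₁ * Q).trace.re
      + (B * Q * M₃ * Q * M₁ * Q * M₂ * Q).trace.re := by
    rw [hG, Matrix.mul_add, Matrix.mul_add, trace_add, trace_add, Complex.add_re, Complex.add_re]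
    simp only [Matrix.mul_assoc]
  have hBGH : (B * Q * Gᴴ).trace.re = (Q * M₂ * Q * (M₃ * Bᴴ * M₁)).trace.re + (Q * M₃ * Q * (M₁ * Bᴴ * M₂)).trace.re
      + (Q * M₁ * Q * (M₂ * Bᴴ * M₃)).trace.re := by
    -- `Re tr(BQ Wᴴ) = Re tr(W (BQ)ᴴ)` and `(BQ)ᴴ = Qᴴ Bᴴ`; then `Q … Q Qᴴ = Q …`
    have key : ∀ A C D : Matrix (Fin N) (Fin N) ℂ,
        (B * Q * (A * Q * C * Q * D * Q)ᴴ).trace.re = (Q * C * Q * (D * Bᴴ * A)).trace.re := by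
      intro A C D
      have hre : ∀ X : Matrix (Fin N) (Fin N) ℂ, Xᴴ.trace.re = X.trace.re := fun X => by
        rw [trace_conjTranspose, Complex.star_def, Complex.conj_re]
      rw [← hre, conjTranspose_mul, conjTranspose_conjTranspose, conjTranspose_mul]
      -- `(A Q C Q D Q) (Qᴴ Bᴴ)` → cyclic → `Q C Q (D Bᴴ A)`
      rw [show A * Q * C * Q * D * Q * (Qᴴ * Bᴴ) = A * Q * C * Q * D * (Q * Qᴴ) * Bᴴ by simp only [Matrix.mul_assoc], hQQ,
        Matrix.mul_one, show A * Q * C * Q * D * Bᴴ = A * (Q * C * Q * (D * Bᴴ)) by simp only [Matrix.mul_assoc], trace_mul_comm]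
      simp only [Matrix.mul_assoc]
    rw [hG, conjTranspose_add, conjTranspose_add, Matrix.mul_add, Matrix.mul_add, trace_add, trace_add, Complex.add_re,
      Complex.add_re, key, key, key]
  have hImG : G.trace.im = 3 * (Q * M₁ * Q * M₂ * Q * M₃).trace.im := by
    have c1 : (M₁ * Q * M₂ * Q * M₃ * Q).trace = (Q * M₁ * Q * M₂ * Q * M₃).trace := by
      rw [show M₁ * Q * M₂ * Q * M₃ * Q = (M₁ * Q * M₂ * Q * M₃) * Q by simp only [Matrix.mul_assoc], trace_mul_comm]
      simp only [Matrix.mul_assoc]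
    have c2 : (M₂ * Q * M₃ * Q * M₁ * Q).trace = (Q * M₁ * Q * M₂ * Q * M₃).trace := by
      rw [show M₂ * Q * M₃ * Q * M₁ * Q = (M₂ * Q * M₃) * (Q * M₁ * Q) by simp only [Matrix.mul_assoc], trace_mul_comm]
      simp only [Matrix.mul_assoc]
    have c3 : (M₃ * Q * M₁ * Q * M₂ * Q).trace = (Q * M₁ * Q * M₂ * Q * M₃).trace := by
      rw [show M₃ * Q * M₁ * Q * M₂ * Q = M₃ * (Q * M₁ * Q * M₂ * Q) by simp only [Matrix.mul_assoc], trace_mul_comm]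
    rw [hG, trace_add, trace_add, Complex.add_im, Complex.add_im, c1, c2, c3]
    ring
  have hImB : (B * Q).trace.im = (B * Q).trace.im := rfl
  rw [hBG, hBGH, hImG]
  ring

end Calc

end Summit.Ventures.YMGap.OneLinkEigen
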